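import Mathlib
import HarnessLib
import Summits.ValiantsHypothesis.ValiantsHypothesis.Theorems.LacunarySymmetroidMatrixDescartesOsculationLawGPArcSheets
import Summits.ValiantsHypothesis.ValiantsHypothesis.Theorems.LacunarySymmetroidMatrixDescartesOsculationLawGPArcTransport
import Summits.ValiantsHypothesis.ValiantsHypothesis.Theorems.LacunarySymmetroidMatrixDescartesOsculationLawGPDensityOsc
import Summits.ValiantsHypothesis.ValiantsHypothesis.Theorems.LacunarySymmetroidMatrixDescartesOsculationLawRecursionWitnessCurve

/-!
# ValiantsHypothesis / LacunarySymmetroid — crux `MatrixDescartes` (stmt-ValiantsHypothesis-18050, V1),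
# line `Cruxes/MatrixDescartes/Lines/osculation_law.lean` («osculation-law»), stub `stub_recursion`, ROUTE′ density residue:
# THE (a1) PROVIDER — ARC AVOIDANCE AT NODE ONE, COFINITELY IN THE SHIFT AND IN THE SEGMENT PARAMETER

Provider for val-port-3 g1's density theorem `GPDensity.gpNodeDensePrime_of_arc (harc0) (harc1)`: `arc0_cofinite` is the
EXACT text `HOME/lmr/staged/port3-arcspec0.txt` (frame `GPDensity.mem_closure_nodeFamilyPrime`, condition (a1) «no osculation
point of the node-1 curve on `b = C·t^(d_j)`» along the segment `S_ε = (1−ε)T + εW` to the diagonal witness `W_l = −diag(σ_l)`).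

* `X_mul_derivative_C_mul_X_pow`, `X_mul_derivative_sum` — the Euler operator `θ = t·d/dt` on fewnomials;
* **`isCoprime_arc_node_one`** — at a fixed shift `C ≠ 0`, sheets `C 1·X₁ + ι(g_i)`: if each `C·X^N + g_i` is coprime to the
  reduced log-Wronskian of `g_i` and to every `g_i − g_j`, then `Φ(t, C t^N)` and `H(Φ)(t, C t^N)` are coprime
  (`isCoprime_arc_logHessian_prod`, `arc_sheet`, `arc_logHessian_sheet`);
* **`finite_bad_shift_arc_node_one`** — hence only finitely many shifts `C` are bad (`finite_setOf_not_isCoprime_C_mul_X_pow_add`),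
  given `g_i(0) ≠ 0`, `(g_i − g_j)(0) ≠ 0`, `W(g_i) ≠ 0`;
* `segment_const`, `arc_det_master` — bookkeeping for the master curve over `ℝ[ε]` (val-lit-p5 g12's `map_segmentModel`);
* ★ **`arc0_cofinite`** — the (a1) provider: witness fewnomials `g_i = Σ_(l<j) σ_(l,i) t^(d_l)` satisfy the three conditions
  (`d₀ = 0`, positivity, letter-0 distinctness, `j ≥ 2` via val-lit-p4 g13's `logWronskian_sum_pos`), the `t`-leading
  coefficient on the arc is `C^m` (`leadingCoeff_det_pencil_arc`), and `arc_osc_cofinite_of_master` transports along `ε`.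

Honest framing: helper lemmas toward the OPEN stub `stub_recursion` (one of the two arc clauses of its density residue);
the LAW `stub_osculationLaw`, `MatrixDescartes` (18050) and `VP ≠ VNP` are NOT proved.  No definitions, no named facts.
-/

-- `Summit.ValiantsHypothesis.ValiantsHypothesis.…` is the tree's mandated single-conjunct layout (Sub = Summit).
set_option linter.dupNamespace false

noncomputable section

namespace Summit.ValiantsHypothesis.ValiantsHypothesis.Theorems.LacunarySymmetroidMatrixDescartes

open Polynomial

namespace OsculationGeneric

/-! ### Small algebra -/

/-- A polynomial not vanishing at `0` is coprime to `X`. [folklore] -/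
theorem isCoprime_X_of_eval_zero_ne_zero (p : ℝ[X]) (h : p.eval 0 ≠ 0) : IsCoprime p X := by
  have hc : p.coeff 0 ≠ 0 := by rwa [coeff_zero_eq_eval_zero]
  have hunit : IsCoprime X (Polynomial.C (p.coeff 0)) :=
    ⟨0, Polynomial.C (p.coeff 0)⁻¹, by rw [zero_mul, zero_add, ← C_mul, inv_mul_cancel₀ hc, C_1]⟩
  have h2 : IsCoprime X (Polynomial.C (p.coeff 0) + X * p.divX) := hunit.add_mul_left_right _
  rw [add_comm, X_mul_divX_add] at h2
  exact h2.symm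

/-- Everything is coprime to a nonzero constant. [folklore] -/
theorem isCoprime_C_of_ne_zero (p : ℝ[X]) {c : ℝ} (hc : c ≠ 0) : IsCoprime p (Polynomial.C c) :=
  ⟨0, Polynomial.C c⁻¹, by rw [zero_mul, zero_add, ← C_mul, inv_mul_cancel₀ hc, C_1]⟩

/-- `θ(a·X^n) = (a·n)·X^n` for the Euler operator `θ = X·d/dX`. [folklore] -/
theorem X_mul_derivative_C_mul_X_pow (a : ℝ) (n : ℕ) :
    X * derivative (Polynomial.C a * X ^ n) = Polynomial.C (a * n) * X ^ n := by
  rcases n with _ | n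
  · simp
  · rw [derivative_C_mul_X_pow, Nat.add_sub_cancel]
    ring

/-- `θ` on a fewnomial. [folklore] -/
theorem X_mul_derivative_sum {n : ℕ} (A : Fin n → ℝ) (e : Fin n → ℕ) :
    X * derivative (∑ l, Polynomial.C (A l) * X ^ e l) = ∑ l, Polynomial.C (A l * e l) * X ^ e l := by
  rw [map_sum, Finset.mul_sum]
  exact Finset.sum_congr rfl fun l _ => X_mul_derivative_C_mul_X_pow _ _

/-! ### Node one at a fixed shift -/

/-- **Node-one arc coprimality at a fixed shift.**  Sheets `C 1·X₁ + ι(g_i)`, arc `b = C·t^N` (`C ≠ 0`, `N ≥ 1`): if every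
`f_i = C(C)·X^N + g_i` has `g_i(0) ≠ 0`, is coprime to a polynomial `W'_i` with `W(g_i) = X^μ_i·W'_i`
(`W(g) = g·θ²g − (θg)²`), and is coprime to every `g_i − g_j` (`j ≠ i`), then the arc restrictions of `Φ = Π_i (C 1·X₁ + ι g_i)`
and of `H(Φ)` are coprime. [folklore] -/
theorem isCoprime_arc_node_one {ι : Type*} [Fintype ι] [DecidableEq ι] (g : ι → ℝ[X]) (C : ℝ) (N : ℕ) (hC : C ≠ 0)
    (hN : 0 < N) (hg0 : ∀ i, (g i).eval 0 ≠ 0) (W' : ι → ℝ[X]) (μ : ι → ℕ)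
    (hW : ∀ i, g i * (X * derivative (X * derivative (g i))) - (X * derivative (g i)) ^ 2 = X ^ μ i * W' i)
    (h1 : ∀ i, IsCoprime (Polynomial.C C * X ^ N + g i) (W' i))
    (h2 : ∀ i j, i ≠ j → IsCoprime (Polynomial.C C * X ^ N + g i) (g i - g j)) :
    IsCoprime ((MvPolynomial.aeval (![Polynomial.X, Polynomial.C C * Polynomial.X ^ N] : Fin 2 → ℝ[X])) (∏ i, (MvPolynomial.C 1 * MvPolynomial.X 1 + Polynomial.aeval (MvPolynomial.X 0 : MvPolynomial (Fin 2) ℝ) (g i))))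
      ((MvPolynomial.aeval (![Polynomial.X, Polynomial.C C * Polynomial.X ^ N] : Fin 2 → ℝ[X]))
        (MvPolynomial.X 0 * MvPolynomial.pderiv 0 (MvPolynomial.X 0 * MvPolynomial.pderiv 0 (∏ i, (MvPolynomial.C 1 * MvPolynomial.X 1 + Polynomial.aeval (MvPolynomial.X 0 : MvPolynomial (Fin 2) ℝ) (g i))))
            * (MvPolynomial.X 1 * MvPolynomial.pderiv 1 (∏ i, (MvPolynomial.C 1 * MvPolynomial.X 1 + Polynomial.aeval (MvPolynomial.X 0 : MvPolynomial (Fin 2) ℝ) (g i)))) ^ 2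
          - 2 * (MvPolynomial.X 0 * MvPolynomial.pderiv 0 (MvPolynomial.X 1 * MvPolynomial.pderiv 1 (∏ i, (MvPolynomial.C 1 * MvPolynomial.X 1 + Polynomial.aeval (MvPolynomial.X 0 : MvPolynomial (Fin 2) ℝ) (g i)))))
            * (MvPolynomial.X 0 * MvPolynomial.pderiv 0 (∏ i, (MvPolynomial.C 1 * MvPolynomial.X 1 + Polynomial.aeval (MvPolynomial.X 0 : MvPolynomial (Fin 2) ℝ) (g i)))) * (MvPolynomial.X 1 * MvPolynomial.pderiv 1 (∏ i, (MvPolynomial.C 1 * MvPolynomial.X 1 + Polynomial.aeval (MvPolynomial.X 0 : MvPolynomial (Fin 2) ℝ) (g i))))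
          + MvPolynomial.X 1 * MvPolynomial.pderiv 1 (MvPolynomial.X 1 * MvPolynomial.pderiv 1 (∏ i, (MvPolynomial.C 1 * MvPolynomial.X 1 + Polynomial.aeval (MvPolynomial.X 0 : MvPolynomial (Fin 2) ℝ) (g i))))
            * (MvPolynomial.X 0 * MvPolynomial.pderiv 0 (∏ i, (MvPolynomial.C 1 * MvPolynomial.X 1 + Polynomial.aeval (MvPolynomial.X 0 : MvPolynomial (Fin 2) ℝ) (g i)))) ^ 2)) := by
  have harc : ∀ i, (MvPolynomial.aeval (![Polynomial.X, Polynomial.C C * Polynomial.X ^ N] : Fin 2 → ℝ[X])) (MvPolynomial.C 1 * MvPolynomial.X 1 + Polynomial.aeval (MvPolynomial.X 0 : MvPolynomial (Fin 2) ℝ) (g i)) = Polynomial.C C * X ^ N + g i := fun i => by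
    rw [arc_sheet, one_mul]
  have hX : ∀ i, IsCoprime (Polynomial.C C * X ^ N + g i) X := fun i => by
    refine isCoprime_X_of_eval_zero_ne_zero _ ?_
    rw [eval_add, eval_mul, eval_C, eval_pow, eval_X, zero_pow hN.ne', mul_zero, zero_add]
    exact hg0 i
  have hCX : ∀ i, IsCoprime (Polynomial.C C * X ^ N + g i) (Polynomial.C C * X ^ N) := fun i =>
    (isCoprime_C_of_ne_zero _ hC).mul_right (hX i).pow_right
  refine isCoprime_arc_logHessian_prod Finset.univ (fun i => (MvPolynomial.C 1 * MvPolynomial.X 1 + Polynomial.aeval (MvPolynomial.X 0 : MvPolynomial (Fin 2) ℝ) (g i))) C N (fun i _ j _ hij => ?_) (fun i _ => ?_)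
  · rw [harc, harc]
    have e : Polynomial.C C * X ^ N + g j = -(g i - g j) + (Polynomial.C C * X ^ N + g i) * 1 := by ring
    rw [e]
    exact (h2 i j hij).neg_right.add_mul_left_right 1
  · rw [arc_logHessian_sheet, harc, one_mul]
    refine (hCX i).mul_right ?_
    have e : Polynomial.C C * X ^ N * (X * derivative (X * derivative (g i))) + (X * derivative (g i)) ^ 2 =
        -(g i * (X * derivative (X * derivative (g i))) - (X * derivative (g i)) ^ 2) +
          (Polynomial.C C * X ^ N + g i) * (X * derivative (X * derivative (g i))) := by ring
    rw [e, hW i]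
    exact ((hX i).pow_right.mul_right (h1 i)).neg_right.add_mul_left_right _

/-- **Finitely many bad shifts at node one.**  For sheets `C 1·X₁ + ι(g_i)` with `g_i(0) ≠ 0`, `(g_i − g_j)(0) ≠ 0` (`i ≠ j`) and
nonzero log-Wronskians `W(g_i)`, the set of shifts `C` for which the arc restrictions (`b = C·t^N`, `N ≥ 1`) of `Φ` and `H(Φ)`
fail to be coprime is finite. [folklore] -/
theorem finite_bad_shift_arc_node_one {ι : Type*} [Fintype ι] [DecidableEq ι] (g : ι → ℝ[X]) (N : ℕ) (hN : 0 < N)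
    (hg0 : ∀ i, (g i).eval 0 ≠ 0) (hgij : ∀ i j, i ≠ j → (g i - g j).eval 0 ≠ 0)
    (hWr : ∀ i, g i * (X * derivative (X * derivative (g i))) - (X * derivative (g i)) ^ 2 ≠ 0) :
    {C : ℝ | ¬ IsCoprime ((MvPolynomial.aeval (![Polynomial.X, Polynomial.C C * Polynomial.X ^ N] : Fin 2 → ℝ[X])) (∏ i, (MvPolynomial.C 1 * MvPolynomial.X 1 + Polynomial.aeval (MvPolynomial.X 0 : MvPolynomial (Fin 2) ℝ) (g i))))
      ((MvPolynomial.aeval (![Polynomial.X, Polynomial.C C * Polynomial.X ^ N] : Fin 2 → ℝ[X]))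
        (MvPolynomial.X 0 * MvPolynomial.pderiv 0 (MvPolynomial.X 0 * MvPolynomial.pderiv 0 (∏ i, (MvPolynomial.C 1 * MvPolynomial.X 1 + Polynomial.aeval (MvPolynomial.X 0 : MvPolynomial (Fin 2) ℝ) (g i))))
            * (MvPolynomial.X 1 * MvPolynomial.pderiv 1 (∏ i, (MvPolynomial.C 1 * MvPolynomial.X 1 + Polynomial.aeval (MvPolynomial.X 0 : MvPolynomial (Fin 2) ℝ) (g i)))) ^ 2
          - 2 * (MvPolynomial.X 0 * MvPolynomial.pderiv 0 (MvPolynomial.X 1 * MvPolynomial.pderiv 1 (∏ i, (MvPolynomial.C 1 * MvPolynomial.X 1 + Polynomial.aeval (MvPolynomial.X 0 : MvPolynomial (Fin 2) ℝ) (g i)))))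
            * (MvPolynomial.X 0 * MvPolynomial.pderiv 0 (∏ i, (MvPolynomial.C 1 * MvPolynomial.X 1 + Polynomial.aeval (MvPolynomial.X 0 : MvPolynomial (Fin 2) ℝ) (g i)))) * (MvPolynomial.X 1 * MvPolynomial.pderiv 1 (∏ i, (MvPolynomial.C 1 * MvPolynomial.X 1 + Polynomial.aeval (MvPolynomial.X 0 : MvPolynomial (Fin 2) ℝ) (g i))))
          + MvPolynomial.X 1 * MvPolynomial.pderiv 1 (MvPolynomial.X 1 * MvPolynomial.pderiv 1 (∏ i, (MvPolynomial.C 1 * MvPolynomial.X 1 + Polynomial.aeval (MvPolynomial.X 0 : MvPolynomial (Fin 2) ℝ) (g i))))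
            * (MvPolynomial.X 0 * MvPolynomial.pderiv 0 (∏ i, (MvPolynomial.C 1 * MvPolynomial.X 1 + Polynomial.aeval (MvPolynomial.X 0 : MvPolynomial (Fin 2) ℝ) (g i)))) ^ 2))}.Finite := by
  classical
  -- strip the powers of `X` from the log-Wronskians
  have hdec : ∀ i, ∃ (W' : ℝ[X]) (μ : ℕ),
      g i * (X * derivative (X * derivative (g i))) - (X * derivative (g i)) ^ 2 = X ^ μ * W' ∧ W' ≠ 0 ∧ W'.eval 0 ≠ 0 := by
    intro i
    obtain ⟨W', hW', hndvd⟩ := Polynomial.exists_eq_pow_rootMultiplicity_mul_and_not_dvd _ (hWr i) 0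
    rw [Polynomial.C_0, sub_zero] at hW' hndvd
    refine ⟨W', _, hW', ?_, ?_⟩
    · rintro rfl; exact hndvd (dvd_zero _)
    · intro h0; exact hndvd (Polynomial.X_dvd_iff.2 (by rwa [coeff_zero_eq_eval_zero]))
  choose W' μ hW hW0 hW0' using hdec
  -- the finite bad set
  have hfin : (({0} ∪ ⋃ i, {C : ℝ | ¬ IsCoprime (Polynomial.C C * X ^ N + g i) (W' i)}) ∪
      ⋃ i, ⋃ j, ⋃ (_ : i ≠ j), {C : ℝ | ¬ IsCoprime (Polynomial.C C * X ^ N + g i) (g i - g j)}).Finite := by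
    refine ((Set.finite_singleton 0).union (Set.finite_iUnion fun i => ?_)).union
      (Set.finite_iUnion fun i => Set.finite_iUnion fun j => Set.finite_iUnion fun hij => ?_)
    · exact finite_setOf_not_isCoprime_C_mul_X_pow_add _ _ N (hW0 i) (hW0' i)
    · refine finite_setOf_not_isCoprime_C_mul_X_pow_add _ _ N ?_ (hgij i j hij)
      intro h0; exact hgij i j hij (by rw [h0, eval_zero])
  refine hfin.subset fun C hC => ?_
  by_contra hmem
  simp only [Set.mem_union, Set.mem_singleton_iff, Set.mem_iUnion, Set.mem_setOf_eq, not_or, not_exists,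
    not_not] at hmem
  obtain ⟨⟨hC0, h1⟩, h2⟩ := hmem
  exact hC (isCoprime_arc_node_one g C N hC0 hN hg0 W' μ hW h1 fun i j hij => h2 i j hij)

/-! ### Bookkeeping for the master curve over `ℝ[ε]` -/

/-- A constant segment: `M(1−ε) + Mε = M` entrywise over `ℝ[ε]`. [folklore] -/
theorem segment_const {ι : Type*} (M : Matrix ι ι ℝ) :
    M.map (fun s : ℝ => Polynomial.C s * (1 - Polynomial.X)) + M.map (fun w : ℝ => Polynomial.C w * Polynomial.X) = M.map (Polynomial.C : ℝ → ℝ[X]) := by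
  ext i j
  simp only [Matrix.add_apply, Matrix.map_apply]
  ring

/-- The arc restriction (over `ℝ[ε]`, arc coefficient `C (C C)`) of a determinantal master curve is the determinant of the
arc-restricted matrix. [folklore] -/
theorem arc_det_master {ι : Type*} [Fintype ι] [DecidableEq ι] {k : ℕ} (e : Fin k → ℕ) (𝔖 : Fin k → Matrix ι ι ℝ[X])
    (B : Matrix ι ι ℝ[X]) (C : ℝ) (N : ℕ) :
    (MvPolynomial.aeval (![Polynomial.X, Polynomial.C (Polynomial.C C) * Polynomial.X ^ N] : Fin 2 → ℝ[X][X]))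
        (∑ l, (MvPolynomial.X (0 : Fin 2) : MvPolynomial (Fin 2) ℝ[X]) ^ e l • (𝔖 l).map (MvPolynomial.C : ℝ[X] →+* MvPolynomial (Fin 2) ℝ[X]) +
          (MvPolynomial.X (1 : Fin 2) : MvPolynomial (Fin 2) ℝ[X]) • B.map (MvPolynomial.C : ℝ[X] →+* MvPolynomial (Fin 2) ℝ[X])).det =
      (∑ l, (Polynomial.X : ℝ[X][X]) ^ e l • (𝔖 l).map Polynomial.C +
        (Polynomial.C (Polynomial.C C) * Polynomial.X ^ N) • B.map Polynomial.C).det := by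
  rw [AlgHom.map_det, AlgHom.mapMatrix_apply]
  congr 1
  ext i j
  simp only [Matrix.map_apply, Matrix.add_apply, Matrix.sum_apply, Matrix.smul_apply, smul_eq_mul, map_add, map_sum,
    map_mul, map_pow, MvPolynomial.aeval_X, MvPolynomial.aeval_C, Matrix.cons_val_zero, Matrix.cons_val_one,
    Polynomial.algebraMap_eq]

/-- The frame's node-1 curve at parameter `ε` is the specialisation of the master curve over `ℝ[ε]`
(val-lit-p5 g12's `map_segmentModel` + `node0_det_eq`). [folklore] -/
theorem frame0_eq_map_master (m K j : ℕ) (d : Fin (K + 1) → ℕ)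
    (T W : Fin (K + 1) → Matrix (Fin m ⊕ Fin 0) (Fin m ⊕ Fin 0) ℝ) (h : j + 1 ≤ K + 1) (ε : ℝ) :
    MvPolynomial.map (Polynomial.evalRingHom ε) (∑ l, (MvPolynomial.X (0 : Fin 2) : MvPolynomial (Fin 2) ℝ[X]) ^ (fun l => d (Fin.castLE h (Fin.castSucc l))) l • (((fun l => -(T (Fin.castLE h (Fin.castSucc l)))) l).map (fun s : ℝ => Polynomial.C s * (1 - Polynomial.X)) + ((fun l => -(W (Fin.castLE h (Fin.castSucc l)))) l).map (fun w : ℝ => Polynomial.C w * Polynomial.X)).map (MvPolynomial.C : ℝ[X] →+* MvPolynomial (Fin 2) ℝ[X]) + (MvPolynomial.X (1 : Fin 2) : MvPolynomial (Fin 2) ℝ[X]) • ((1 : Matrix (Fin m ⊕ Fin 0) (Fin m ⊕ Fin 0) ℝ).map (fun s : ℝ => Polynomial.C s * (1 - Polynomial.X)) + (1 : Matrix (Fin m ⊕ Fin 0) (Fin m ⊕ Fin 0) ℝ).map (fun w : ℝ => Polynomial.C w * Polynomial.X)).map (MvPolynomial.C : ℝ[X] →+* MvPolynomial (Fin 2)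 ℝ[X])).det =
      (∑ l, (MvPolynomial.X (0 : Fin 2) : MvPolynomial (Fin 2) ℝ) ^ (fun l => d (Fin.castLE h
    (Fin.castSucc l))) l • ((fun l => -(((1 - ε) • T + ε • W) (Fin.castLE h (Fin.castSucc l)))) l).map (MvPolynomial.C : ℝ →+* MvPolynomial (Fin 2) ℝ) +
    (MvPolynomial.X (1 : Fin 2) : MvPolynomial (Fin 2) ℝ) • (Matrix.fromBlocks 1 0 0 0 : Matrix (Fin m ⊕ Fin 0) (Fin m ⊕ Fin 0) ℝ).map (MvPolynomial.C : ℝ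
    →+* MvPolynomial (Fin 2) ℝ)).det := by
  rw [OsculationUniform.map_segmentModel (fun l => d (Fin.castLE h (Fin.castSucc l))) (fun l => -(T (Fin.castLE h (Fin.castSucc l)))) (fun l => -(W (Fin.castLE h (Fin.castSucc l)))) (1 : Matrix (Fin m ⊕ Fin 0) (Fin m ⊕ Fin 0) ℝ) (1 : Matrix (Fin m ⊕ Fin 0) (Fin m ⊕ Fin 0) ℝ) ε,
    OsculationUniform.node0_det_eq m K j d T W h ε]

/-- At `ε = 1` the frame's node-1 matrix of the diagonal witness is the diagonal matrix of the witness sheets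
`C 1·X₁ + ι(g_i)`, `g_i = Σ_(l<j) σ_(l,i) t^(d_l)`. [folklore] -/
theorem frame0_witness_eq_diagonal (m K j : ℕ) (d : Fin (K + 1) → ℕ) (σ : Fin (K + 1) → (Fin m ⊕ Fin 0) → ℝ)
    (T W : Fin (K + 1) → Matrix (Fin m ⊕ Fin 0) (Fin m ⊕ Fin 0) ℝ) (hW : ∀ l, W l = -Matrix.diagonal (σ l))
    (h : j + 1 ≤ K + 1) :
    (∑ l, (MvPolynomial.X (0 : Fin 2) : MvPolynomial (Fin 2) ℝ) ^ (fun l => d (Fin.castLE h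
    (Fin.castSucc l))) l • ((fun l => -(((1 - (1 : ℝ)) • T + (1 : ℝ) • W) (Fin.castLE h (Fin.castSucc l)))) l).map (MvPolynomial.C : ℝ →+* MvPolynomial (Fin 2) ℝ) +
    (MvPolynomial.X (1 : Fin 2) : MvPolynomial (Fin 2) ℝ) • (Matrix.fromBlocks 1 0 0 0 : Matrix (Fin m ⊕ Fin 0) (Fin m ⊕ Fin 0) ℝ).map (MvPolynomial.C : ℝ
    →+* MvPolynomial (Fin 2) ℝ)) =
      Matrix.diagonal fun i => (MvPolynomial.C 1 * MvPolynomial.X 1 + Polynomial.aeval (MvPolynomial.X 0 : MvPolynomial (Fin 2) ℝ)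
        (∑ l : Fin j, Polynomial.C (σ (Fin.castLE h (Fin.castSucc l)) i) * X ^ d (Fin.castLE h (Fin.castSucc l)))) := by
  refine Matrix.ext fun i i' => ?_
  simp only [Matrix.add_apply, Matrix.sum_apply, Matrix.smul_apply, Matrix.map_apply, Pi.add_apply,
    Pi.zero_apply, sub_self, zero_smul, zero_add, one_smul, hW, Matrix.diagonal_apply, neg_neg,
    OsculationUniform.fromBlocks_one_fin_zero, Matrix.one_apply, smul_eq_mul]
  split_ifs with hii'
  · subst hii'
    rw [MvPolynomial.C_1, mul_one, one_mul, add_comm]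
    simp only [map_sum, map_mul, map_pow, Polynomial.aeval_C, Polynomial.aeval_X, MvPolynomial.algebraMap_eq]
    congr 1
    exact Finset.sum_congr rfl fun l _ => mul_comm _ _
  · simp

/-! ### The (a1) provider in the frame's spelling -/

/-- ★ **`arc0_cofinite`** — the (a1) provider for val-port-3 g1's `gpNodeDensePrime_of_arc` (text `port3-arcspec0.txt`): for the
diagonal witness `W_l = −diag(σ_l)` (entries positive, distinct within every letter, `d₀ = 0`, `d` strictly increasing) and every
level `j ≥ 2` there is a finite set `F` of shifts such that for every `C ∉ F`, `C > 0`, every symmetric `T`, and all `ε` off a finite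
set, NO point of the osculation-type set of the node-1 curve of `S_ε = (1−ε)T + εW` at level `j` lies on the arc `b = C·t^(d_j)`.
[folklore] -/
theorem arc0_cofinite :
    ∀ (m K j : ℕ), 2 ≤ j → ∀ (d : Fin (K + 1) → ℕ), StrictMono d → d 0 = 0 →
    ∀ (σ : Fin (K + 1) → (Fin m ⊕ Fin 0) → ℝ), (∀ l i, 0 < σ l i) → (∀ l i i', i ≠ i' → σ l i ≠ σ l i') →
    ∀ (W : Fin (K + 1) → Matrix (Fin m ⊕ Fin 0) (Fin m ⊕ Fin 0) ℝ), (∀ l, W l = -Matrix.diagonal (σ l)) →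
    ∀ (h : j + 1 ≤ K + 1), ∃ F : Set ℝ, F.Finite ∧ ∀ (C : ℝ), C ∉ F → 0 < C → (∀ l i, σ l i < C) →
    ∀ (T : Fin (K + 1) → Matrix (Fin m ⊕ Fin 0) (Fin m ⊕ Fin 0) ℝ), (∀ l, (T l).IsSymm) →
    ∃ B : Set ℝ, B.Finite ∧ ∀ ε : ℝ, ε ∉ B →
    (∀ p ∈ {p : Fin 2 → ℝ | 0 < p 0 ∧ 0 < p 1 ∧ MvPolynomial.eval p (∑ l, (MvPolynomial.X (0 : Fin 2) : MvPolynomial (Fin 2) ℝ) ^ (fun l => d (Fin.castLE h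
    (Fin.castSucc l))) l • ((fun l => -(((1 - ε) • T + ε • W) (Fin.castLE h (Fin.castSucc l)))) l).map (MvPolynomial.C : ℝ →+* MvPolynomial (Fin 2) ℝ) +
    (MvPolynomial.X (1 : Fin 2) : MvPolynomial (Fin 2) ℝ) • (Matrix.fromBlocks 1 0 0 0 : Matrix (Fin m ⊕ Fin 0) (Fin m ⊕ Fin 0) ℝ).map (MvPolynomial.C : ℝ
    →+* MvPolynomial (Fin 2) ℝ)).det = 0 ∧ MvPolynomial.eval p (MvPolynomial.X 0 * MvPolynomial.pderiv 0 (MvPolynomial.X 0 * MvPolynomial.pderiv 0 (∑ l,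
    (MvPolynomial.X (0 : Fin 2) : MvPolynomial (Fin 2) ℝ) ^ (fun l => d (Fin.castLE h (Fin.castSucc l))) l • ((fun l => -(((1 - ε) • T + ε • W)
    (Fin.castLE h (Fin.castSucc l)))) l).map (MvPolynomial.C : ℝ →+* MvPolynomial (Fin 2) ℝ) + (MvPolynomial.X (1 : Fin 2) : MvPolynomial (Fin 2) ℝ) •
    (Matrix.fromBlocks 1 0 0 0 : Matrix (Fin m ⊕ Fin 0) (Fin m ⊕ Fin 0) ℝ).map (MvPolynomial.C : ℝ →+* MvPolynomial (Fin 2) ℝ)).det) * (MvPolynomial.X 1 *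
    MvPolynomial.pderiv 1 (∑ l, (MvPolynomial.X (0 : Fin 2) : MvPolynomial (Fin 2) ℝ) ^ (fun l => d (Fin.castLE h (Fin.castSucc l))) l • ((fun l => -(((1
    - ε) • T + ε • W) (Fin.castLE h (Fin.castSucc l)))) l).map (MvPolynomial.C : ℝ →+* MvPolynomial (Fin 2) ℝ) + (MvPolynomial.X (1 : Fin 2) :
    MvPolynomial (Fin 2) ℝ) • (Matrix.fromBlocks 1 0 0 0 : Matrix (Fin m ⊕ Fin 0) (Fin m ⊕ Fin 0) ℝ).map (MvPolynomial.C : ℝ →+* MvPolynomial (Fin 2)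
    ℝ)).det) ^ 2 - 2 * (MvPolynomial.X 0 * MvPolynomial.pderiv 0 (MvPolynomial.X 1 * MvPolynomial.pderiv 1 (∑ l, (MvPolynomial.X (0 : Fin 2) :
    MvPolynomial (Fin 2) ℝ) ^ (fun l => d (Fin.castLE h (Fin.castSucc l))) l • ((fun l => -(((1 - ε) • T + ε • W) (Fin.castLE h (Fin.castSucc l)))) l).map
    (MvPolynomial.C : ℝ →+* MvPolynomial (Fin 2) ℝ) + (MvPolynomial.X (1 : Fin 2) : MvPolynomial (Fin 2) ℝ) • (Matrix.fromBlocks 1 0 0 0 : Matrix (Fin m ⊕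
    Fin 0) (Fin m ⊕ Fin 0) ℝ).map (MvPolynomial.C : ℝ →+* MvPolynomial (Fin 2) ℝ)).det)) * (MvPolynomial.X 0 * MvPolynomial.pderiv 0 (∑ l, (MvPolynomial.X
    (0 : Fin 2) : MvPolynomial (Fin 2) ℝ) ^ (fun l => d (Fin.castLE h (Fin.castSucc l))) l • ((fun l => -(((1 - ε) • T + ε • W) (Fin.castLE h
    (Fin.castSucc l)))) l).map (MvPolynomial.C : ℝ →+* MvPolynomial (Fin 2) ℝ) + (MvPolynomial.X (1 : Fin 2) : MvPolynomial (Fin 2) ℝ) •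
    (Matrix.fromBlocks 1 0 0 0 : Matrix (Fin m ⊕ Fin 0) (Fin m ⊕ Fin 0) ℝ).map (MvPolynomial.C : ℝ →+* MvPolynomial (Fin 2) ℝ)).det) * (MvPolynomial.X 1 *
    MvPolynomial.pderiv 1 (∑ l, (MvPolynomial.X (0 : Fin 2) : MvPolynomial (Fin 2) ℝ) ^ (fun l => d (Fin.castLE h (Fin.castSucc l))) l • ((fun l => -(((1
    - ε) • T + ε • W) (Fin.castLE h (Fin.castSucc l)))) l).map (MvPolynomial.C : ℝ →+* MvPolynomial (Fin 2) ℝ) + (MvPolynomial.X (1 : Fin 2) :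
    MvPolynomial (Fin 2) ℝ) • (Matrix.fromBlocks 1 0 0 0 : Matrix (Fin m ⊕ Fin 0) (Fin m ⊕ Fin 0) ℝ).map (MvPolynomial.C : ℝ →+* MvPolynomial (Fin 2)
    ℝ)).det) + MvPolynomial.X 1 * MvPolynomial.pderiv 1 (MvPolynomial.X 1 * MvPolynomial.pderiv 1 (∑ l, (MvPolynomial.X (0 : Fin 2) : MvPolynomial (Fin 2)
    ℝ) ^ (fun l => d (Fin.castLE h (Fin.castSucc l))) l • ((fun l => -(((1 - ε) • T + ε • W) (Fin.castLE h (Fin.castSucc l)))) l).map (MvPolynomial.C : ℝ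
    →+* MvPolynomial (Fin 2) ℝ) + (MvPolynomial.X (1 : Fin 2) : MvPolynomial (Fin 2) ℝ) • (Matrix.fromBlocks 1 0 0 0 : Matrix (Fin m ⊕ Fin 0) (Fin m ⊕ Fin
    0) ℝ).map (MvPolynomial.C : ℝ →+* MvPolynomial (Fin 2) ℝ)).det) * (MvPolynomial.X 0 * MvPolynomial.pderiv 0 (∑ l, (MvPolynomial.X (0 : Fin 2) :
    MvPolynomial (Fin 2) ℝ) ^ (fun l => d (Fin.castLE h (Fin.castSucc l))) l • ((fun l => -(((1 - ε) • T + ε • W) (Fin.castLE h (Fin.castSucc l)))) l).map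
    (MvPolynomial.C : ℝ →+* MvPolynomial (Fin 2) ℝ) + (MvPolynomial.X (1 : Fin 2) : MvPolynomial (Fin 2) ℝ) • (Matrix.fromBlocks 1 0 0 0 : Matrix (Fin m ⊕
    Fin 0) (Fin m ⊕ Fin 0) ℝ).map (MvPolynomial.C : ℝ →+* MvPolynomial (Fin 2) ℝ)).det) ^ 2) = 0},
    p 1 ≠ C * p 0 ^ d (Fin.castLE h (Fin.last j))) := by
  intro m K j hj d hd hd0 σ hσ hσ' W hW h
  classical
  -- exponents of the first `j` letters, the arc exponent `N = d_j`, the witness slot fewnomials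
  have hjpos : 0 < j := by omega
  have he0 : d (Fin.castLE h (Fin.castSucc (⟨0, hjpos⟩ : Fin j))) = 0 := by
    have : Fin.castLE h (Fin.castSucc (⟨0, hjpos⟩ : Fin j)) = 0 := Fin.ext (by simp)
    rw [this]; exact hd0
  have hepos : ∀ l : Fin j, l ≠ ⟨0, hjpos⟩ → 0 < d (Fin.castLE h (Fin.castSucc l)) := by
    intro l hl
    rw [← hd0]
    apply hd
    rw [Fin.lt_def]
    have : (l : ℕ) ≠ 0 := fun h0 => hl (Fin.ext h0)
    simp only [Fin.val_castLE, Fin.val_castSucc, Fin.val_zero]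
    omega
  have heN : ∀ l : Fin j, (fun l => d (Fin.castLE h (Fin.castSucc l))) l < d (Fin.castLE h (Fin.last j)) := by
    intro l
    apply hd
    rw [Fin.lt_def]
    simp only [Fin.val_castLE, Fin.val_castSucc, Fin.val_last]
    exact l.isLt
  have hNpos : 0 < d (Fin.castLE h (Fin.last j)) := lt_of_le_of_lt (Nat.zero_le _) (heN ⟨0, hjpos⟩)
  obtain ⟨g, hg⟩ : ∃ g : (Fin m ⊕ Fin 0) → ℝ[X], g = fun i => ∑ l : Fin j,
      Polynomial.C (σ (Fin.castLE h (Fin.castSucc l)) i) * X ^ d (Fin.castLE h (Fin.castSucc l)) := ⟨_, rfl⟩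
  have hg_eval0 : ∀ i, (g i).eval 0 = σ (Fin.castLE h (Fin.castSucc ⟨0, hjpos⟩)) i := by
    intro i
    simp only [hg]
    rw [eval_finsetSum, Finset.sum_eq_single ⟨0, hjpos⟩]
    · rw [eval_mul, eval_C, eval_pow, eval_X, he0, pow_zero, mul_one]
    · intro l _ hl
      rw [eval_mul, eval_C, eval_pow, eval_X, zero_pow (hepos l hl).ne', mul_zero]
    · intro h0; exact absurd (Finset.mem_univ _) h0
  have hg0 : ∀ i, (g i).eval 0 ≠ 0 := fun i => by rw [hg_eval0]; exact (hσ _ _).ne'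
  have hgij : ∀ i i', i ≠ i' → (g i - g i').eval 0 ≠ 0 := fun i i' hii' => by
    rw [eval_sub, hg_eval0, hg_eval0]; exact sub_ne_zero.2 (hσ' _ _ _ hii')
  have hWr : ∀ i, g i * (X * derivative (X * derivative (g i))) - (X * derivative (g i)) ^ 2 ≠ 0 := by
    intro i h0
    have h01 : (fun l : Fin j => d (Fin.castLE h (Fin.castSucc l))) ⟨0, hjpos⟩ ≠
        (fun l : Fin j => d (Fin.castLE h (Fin.castSucc l))) ⟨1, hj⟩ := by
      beta_reduce; rw [he0]; exact (hepos ⟨1, hj⟩ (fun h1 => by simp [Fin.ext_iff] at h1)).ne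
    have hpos := OsculationRecursion.logWronskian_sum_pos (fun l : Fin j => σ (Fin.castLE h (Fin.castSucc l)) i)
      (fun l => d (Fin.castLE h (Fin.castSucc l))) one_pos (fun l => (hσ _ _).le) (hσ _ _) (hσ _ _) h01
    have hev := congr_arg (Polynomial.eval 1) h0
    simp only [hg] at hev
    rw [X_mul_derivative_sum, X_mul_derivative_sum] at hev
    simp only [eval_sub, eval_mul, eval_pow, eval_finsetSum, eval_C, eval_X, one_pow, mul_one, eval_zero] at hev
    simp only [one_pow, mul_one] at hpos
    have e2 : ∀ l : Fin j, σ (Fin.castLE h (Fin.castSucc l)) i * (d (Fin.castLE h (Fin.castSucc l)) : ℝ) *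
        (d (Fin.castLE h (Fin.castSucc l)) : ℝ) =
        σ (Fin.castLE h (Fin.castSucc l)) i * ((d (Fin.castLE h (Fin.castSucc l)) : ℝ) ^ 2) := fun l => by ring
    simp only [e2] at hev
    exact hpos.ne' hev
  -- the finite set of bad shifts (node-1 coprimality at the witness), plus `0`
  have hF := finite_bad_shift_arc_node_one g (d (Fin.castLE h (Fin.last j))) hNpos hg0 hgij hWr
  refine ⟨_, hF, fun C hC hCpos hσC T hT => ?_⟩
  have hcopW := not_not.1 hC
  have hΦ1 : MvPolynomial.map (Polynomial.evalRingHom (1 : ℝ)) (∑ l, (MvPolynomial.X (0 : Fin 2) : MvPolynomial (Fin 2) ℝ[X]) ^ (fun l => d (Fin.castLE h (Fin.castSucc l))) l • (((fun l => -(T (Fin.castLE h (Fin.castSucc l)))) l).map (fun s : ℝ => Polynomial.C s * (1 - Polynomial.X)) + ((fun l => -(W (Fin.castLE h (Fin.castSucc l)))) l).map (fun w : ℝ => Polynomial.C w * Polynomial.X)).map (MvPolynomial.C : ℝ[X] →+* MvPolynomial (Fin 2) ℝ[X]) + (MvPolynomial.X (1 : Fin 2) : MvPolynomial (Fin 2)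 ℝ[X]) • ((1 : Matrix (Fin m ⊕ Fin 0) (Fin m ⊕ Fin 0) ℝ).map (fun s : ℝ => Polynomial.C s * (1 - Polynomial.X)) + (1 : Matrix (Fin m ⊕ Fin 0) (Fin m ⊕ Fin 0) ℝ).map (fun w : ℝ => Polynomial.C w * Polynomial.X)).map (MvPolynomial.C : ℝ[X] →+* MvPolynomial (Fin 2) ℝ[X])).det = (∏ i, (MvPolynomial.C 1 * MvPolynomial.X 1 + Polynomial.aeval (MvPolynomial.X 0 : MvPolynomial (Fin 2) ℝ) (g i))) := by
    rw [frame0_eq_map_master, frame0_witness_eq_diagonal m K j d σ T W hW h, Matrix.det_diagonal, hg]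
  -- the `t`-leading coefficient on the arc is `C^m`
  have hB1 : (1 : Matrix (Fin m ⊕ Fin 0) (Fin m ⊕ Fin 0) ℝ).map (fun s : ℝ => Polynomial.C s * (1 - Polynomial.X)) + (1 : Matrix (Fin m ⊕ Fin 0) (Fin m ⊕ Fin 0) ℝ).map (fun w : ℝ => Polynomial.C w * Polynomial.X) = (1 : Matrix (Fin m ⊕ Fin 0) (Fin m ⊕ Fin 0) ℝ[X]) := by
    rw [segment_const, Matrix.map_one Polynomial.C (map_zero _) (map_one _)]
  have hlc : ((MvPolynomial.aeval (![Polynomial.X, Polynomial.C (Polynomial.C C) * Polynomial.X ^ d (Fin.castLE h (Fin.last j))] : Fin 2 → ℝ[X][X])) (∑ l, (MvPolynomial.X (0 : Fin 2) : MvPolynomial (Fin 2) ℝ[X]) ^ (fun l => d (Fin.castLE h (Fin.castSucc l))) l • (((fun l => -(T (Fin.castLE h (Fin.castSucc l)))) l).map (fun s : ℝ => Polynomial.C s * (1 - Polynomial.X)) + ((fun l => -(W (Fin.castLE h (Fin.castSucc l)))) l).map (fun w : ℝ => Polynomial.C w * Polynomial.X)).map (MvPolynomial.C : ℝ[X] →+*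 MvPolynomial (Fin 2) ℝ[X]) + (MvPolynomial.X (1 : Fin 2) : MvPolynomial (Fin 2) ℝ[X]) • ((1 : Matrix (Fin m ⊕ Fin 0) (Fin m ⊕ Fin 0) ℝ).map (fun s : ℝ => Polynomial.C s * (1 - Polynomial.X)) + (1 : Matrix (Fin m ⊕ Fin 0) (Fin m ⊕ Fin 0) ℝ).map (fun w : ℝ => Polynomial.C w * Polynomial.X)).map (MvPolynomial.C : ℝ[X] →+* MvPolynomial (Fin 2) ℝ[X])).det).leadingCoeff.eval 1 ≠ 0 := by
    rw [arc_det_master, hB1]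
    have hc : (Polynomial.C C) ^ Fintype.card (Fin m ⊕ Fin 0) * (1 : Matrix (Fin m ⊕ Fin 0) (Fin m ⊕ Fin 0) ℝ[X]).det ≠ 0 := by
      rw [Matrix.det_one, mul_one]; exact pow_ne_zero _ (Polynomial.C_ne_zero.2 hCpos.ne')
    rw [(leadingCoeff_det_pencil_arc (fun l => d (Fin.castLE h (Fin.castSucc l))) (d (Fin.castLE h (Fin.last j))) heN _ _ (Polynomial.C C) hc).2, Matrix.det_one, mul_one, eval_pow, eval_C]
    exact pow_ne_zero _ hCpos.ne'
  -- (elaborate the transport lemma at the master curve FIRST, then feed the two certificates: feeding them during the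
  -- application makes the unifier compare huge determinants with pending metavariables)
  have transport := arc_osc_cofinite_of_master (∑ l, (MvPolynomial.X (0 : Fin 2) : MvPolynomial (Fin 2) ℝ[X]) ^ (fun l => d (Fin.castLE h (Fin.castSucc l))) l • (((fun l => -(T (Fin.castLE h (Fin.castSucc l)))) l).map (fun s : ℝ => Polynomial.C s * (1 - Polynomial.X)) + ((fun l => -(W (Fin.castLE h (Fin.castSucc l)))) l).map (fun w : ℝ => Polynomial.C w * Polynomial.X)).map (MvPolynomial.C : ℝ[X] →+* MvPolynomial (Fin 2) ℝ[X]) + (MvPolynomial.X (1 : Fin 2) : MvPolynomial (Fin 2) ℝ[X]) • ((1 : Matrix (Fin m ⊕ Fin 0) (Fin m ⊕ Fin 0) ℝ).map (fun s : ℝ => Polynomial.C s * (1 - Polynomial.X)) + (1 : Matrix (Fin m ⊕ Fin 0) (Fin m ⊕ Fin 0) ℝ).map (fun w : ℝ => Polynomial.C w * Polynomial.X)).map (MvPolynomial.C : ℝ[X] →+* MvPolynomial (Fin 2) ℝ[X])).det C (d (Fin.castLE h (Fin.last j))) 1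
  obtain ⟨B, hB, hgood⟩ := transport hlc (by rw [hΦ1]; exact hcopW)
  refine ⟨B, hB, fun ε hε => ?_⟩
  have key := hgood ε hε
  rw [frame0_eq_map_master m K j d T W h ε] at key
  exact key

end OsculationGeneric

end Summit.ValiantsHypothesis.ValiantsHypothesis.Theorems.LacunarySymmetroidMatrixDescartes

end
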